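import Mathlib
import Summits.ValiantsHypothesis.ValiantsHypothesis.Theorems.LacunarySymmetroidMatrixDescartesInertiaOneAlternationExact

/-!
# `MatrixDescartes` (stmt-ValiantsHypothesis-18050) — INERTIA KIT, IV-h: THE SIGN-SPLIT TYPE CRITERION and
# LOEWNER CHAINS ARE EXACT — a positive root whose kernel Rayleigh coefficients are `≤ 0` below some exponent and `≥ 0`
# above it is of POSITIVE type; on the tree's Loewner-chain sector every positive root is such, so
# `Z₊ + ν(S_top) = ν(S_bottom)` with multiplicity

HONEST FRAMING.  Cell `pub-symmetroid`, seat `val-sym-mdr-p2` (gen 18); helper file `--supports` the crux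
`Theses.LacunarySymmetroid.MatrixDescartes`, NO closure claim.  It upgrades the tree's Loewner-chain INEQUALITY `Z₊ ≤ card ι`
(`chainSector`, `loewnerChain_posRoots_le`; `…ChainSector.lean`, this seat gen 4) to an IDENTITY counted with multiplicity, by the
same route as `…InertiaOneAlternationExact` (gen 18): a per-root TYPE CRITERION fed into the tree's exact one-type count
(`Inertia.card_posRoots_multiset_eq_of_posType`, `…InertiaGlobalIndex.lean`, gen 17).  Nothing here bears on the crux in its
window, on `stub_twoSided`, on `DoorA26`/`DoorA34`, registers, or `VP ≠ VNP`.

RESULTS (namespace `Inertia`; `F(X) = ∑ₖ X^{dₖ}Sₖ` real symmetric, `P_u = ∑ₖ (uᵀSₖu) X^{dₖ}` the Rayleigh `K`-nomial of `u`).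
* `posType_of_signSplit` / `negType_of_signSplit` — THE SIGN-SPLIT TYPE CRITERION: if `F(t)u = 0` (`t > 0`) and for some
  exponent `e` the Rayleigh coefficients satisfy `uᵀSₖu ≤ 0` for `dₖ < e`, `uᵀSₖu ≥ 0` for `dₖ > e` (resp. the reverse), and some
  coefficient off `e` is non-zero, then `P_u′(t) > 0` (resp. `< 0`): **`t·P_u′(t) = t·P_u′(t) − e·P_u(t) = ∑ₖ (dₖ − e)(uᵀSₖu)t^{dₖ}`**
  is a sum of terms of one sign with a non-zero one.  The pivot `e` may depend on the root and on the kernel vector — no sign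
  pattern of the LETTERS is assumed (the semidefinite one-alternation word of `oneAlternation_negType` and the Loewner chains below are
  the two instances in the tree; span-two letters `αₖA − βₖB`, `A, B ⪰ 0`, `αₖ/βₖ` monotone, are a third).
* `chain_posType` — on the tree's Loewner-chain sector (exponents strictly increasing, a pivot INDEX `p`, `Sₗ ⪯ 0` for `l < p`,
  `S_p ⪯ S_{p+1} ⪯ ⋯ ⪯ S_{K−1}`, `det F ≢ 0`) every positive root is of POSITIVE type: for a kernel vector `u` the sequence `uᵀSₖu` is
  `≤ 0` on the head and non-decreasing on the tail, hence sign-split at the first tail index with `uᵀSₖu ≥ 0`; if all coefficients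
  but one vanished, `P_u ≡ 0`, the head letters and the tail differences would kill `u`, and `F(x)u = (∑_{k ≥ p} x^{dₖ})·S_pu = 0`
  for all `x`, i.e. `det F ≡ 0`.
* `chainSector_exact` — **LOEWNER CHAINS ARE EXACT**: with non-singular extreme letters `S₀`, `S_{K−1}`, the positive roots of `det F`
  counted with multiplicity satisfy **`Z₊ + ν(S_{K−1}) = ν(S₀)`** and **`Z₊ + π(S₀) = π(S_{K−1})`**; `loewnerChain_exact` is the headless case
  `S₀ ⪯ ⋯ ⪯ S_{K−1}` (e.g. `X•1 − diag(1,…,n)`: exactly `n`).  The mirror family (PSD head, decreasing chain) is the statement for `−F`.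
[folklore]; axioms `propext`, `Classical.choice`, `Quot.sound`; no definitions.
-/

-- layout Summits/ValiantsHypothesis/ValiantsHypothesis forces the duplicated namespace component
set_option linter.dupNamespace false

namespace Summit.ValiantsHypothesis.ValiantsHypothesis.Theorems.LacunarySymmetroidMatrixDescartes

open Matrix Finset Polynomial
open scoped BigOperators Topology

namespace Inertia

variable {ι : Type} [Fintype ι] [DecidableEq ι] {κ : Type} [Fintype κ]

omit [DecidableEq ι] in
/-- The kernel identity behind the type criteria: if `F(t)u = 0` then for every `e`,
`t · P_u′(t) = ∑ₖ (dₖ − e)·(uᵀSₖu)·t^{dₖ}`. [folklore] -/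
theorem mul_eval_derivative_eq_sum_sub (d : κ → ℕ) (S : κ → Matrix ι ι ℝ) (e : ℕ) (t : ℝ) (u : ι → ℝ)
    (hu : (∑ k, t ^ d k • S k) *ᵥ u = 0) :
    t * (derivative (∑ k, C (u ⬝ᵥ (S k *ᵥ u)) * (X : ℝ[X]) ^ d k)).eval t
      = ∑ k, ((d k : ℝ) - e) * (u ⬝ᵥ (S k *ᵥ u)) * t ^ d k := by
  have hPu : ∑ k, t ^ d k * (u ⬝ᵥ (S k *ᵥ u)) = 0 := by
    have h := OneAlternation.dotProduct_family_mulVec (fun k => t ^ d k) S u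
    rw [hu, dotProduct_zero] at h
    exact h.symm
  rw [mul_eval_derivative_rayleigh]
  have h0 : (e : ℝ) * ∑ k, t ^ d k * (u ⬝ᵥ (S k *ᵥ u)) = 0 := by rw [hPu, mul_zero]
  calc ∑ k, (d k : ℝ) * (u ⬝ᵥ (S k *ᵥ u)) * t ^ d k
      = ∑ k, (d k : ℝ) * (u ⬝ᵥ (S k *ᵥ u)) * t ^ d k - (e : ℝ) * ∑ k, t ^ d k * (u ⬝ᵥ (S k *ᵥ u)) := by
        rw [h0, sub_zero]
    _ = ∑ k, ((d k : ℝ) - e) * (u ⬝ᵥ (S k *ᵥ u)) * t ^ d k := by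
        rw [Finset.mul_sum, ← Finset.sum_sub_distrib]
        refine Finset.sum_congr rfl fun k _ => ?_
        ring

omit [DecidableEq ι] in
/-- **SIGN-SPLIT TYPE CRITERION (positive type).**  `F(t)u = 0` with `t > 0`; the Rayleigh coefficients `uᵀSₖu` are `≤ 0` for
`dₖ < e` and `≥ 0` for `dₖ > e`, and one of them with `dₖ ≠ e` is non-zero.  Then `P_u′(t) > 0`. [folklore] -/
theorem posType_of_signSplit (d : κ → ℕ) (S : κ → Matrix ι ι ℝ) (e : ℕ) (t : ℝ) (ht : 0 < t) (u : ι → ℝ)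
    (hu : (∑ k, t ^ d k • S k) *ᵥ u = 0)
    (hlo : ∀ k, d k < e → u ⬝ᵥ (S k *ᵥ u) ≤ 0) (hhi : ∀ k, e < d k → 0 ≤ u ⬝ᵥ (S k *ᵥ u))
    (hne : ∃ k, d k ≠ e ∧ u ⬝ᵥ (S k *ᵥ u) ≠ 0) :
    0 < (derivative (∑ k, C (u ⬝ᵥ (S k *ᵥ u)) * (X : ℝ[X]) ^ d k)).eval t := by
  set D := (derivative (∑ k, C (u ⬝ᵥ (S k *ᵥ u)) * (X : ℝ[X]) ^ d k)).eval t with hD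
  have hkey := mul_eval_derivative_eq_sum_sub d S e t u hu
  have hterm : ∀ k, 0 ≤ ((d k : ℝ) - e) * (u ⬝ᵥ (S k *ᵥ u)) * t ^ d k := by
    intro k
    have htk : 0 ≤ t ^ d k := pow_nonneg ht.le _
    rcases lt_trichotomy (d k) e with hlt | heq | hgt
    · have hc : (d k : ℝ) - e ≤ 0 := by
        have : (d k : ℝ) < e := by exact_mod_cast hlt
        linarith
      exact mul_nonneg (mul_nonneg_of_nonpos_of_nonpos hc (hlo k hlt)) htk
    · rw [heq, sub_self, zero_mul, zero_mul]
    · have hc : 0 ≤ (d k : ℝ) - e := by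
        have : (e : ℝ) < d k := by exact_mod_cast hgt
        linarith
      exact mul_nonneg (mul_nonneg hc (hhi k hgt)) htk
  obtain ⟨k₀, hk₀, ha₀⟩ := hne
  have hstrict : 0 < ((d k₀ : ℝ) - e) * (u ⬝ᵥ (S k₀ *ᵥ u)) * t ^ d k₀ := by
    have htk : 0 < t ^ d k₀ := pow_pos ht _
    rcases lt_or_gt_of_ne hk₀ with hlt | hgt
    · have hc : (d k₀ : ℝ) - e < 0 := by
        have : (d k₀ : ℝ) < e := by exact_mod_cast hlt
        linarith
      have hq : u ⬝ᵥ (S k₀ *ᵥ u) < 0 := lt_of_le_of_ne (hlo k₀ hlt) ha₀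
      exact mul_pos (mul_pos_of_neg_of_neg hc hq) htk
    · have hc : 0 < (d k₀ : ℝ) - e := by
        have : (e : ℝ) < d k₀ := by exact_mod_cast hgt
        linarith
      have hq : 0 < u ⬝ᵥ (S k₀ *ᵥ u) := lt_of_le_of_ne (hhi k₀ hgt) (Ne.symm ha₀)
      exact mul_pos (mul_pos hc hq) htk
  have hsum : 0 < ∑ k, ((d k : ℝ) - e) * (u ⬝ᵥ (S k *ᵥ u)) * t ^ d k :=
    Finset.sum_pos' (fun k _ => hterm k) ⟨k₀, Finset.mem_univ _, hstrict⟩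
  rw [← hkey] at hsum
  by_contra h
  push Not at h
  have : t * D ≤ 0 := mul_nonpos_of_nonneg_of_nonpos ht.le h
  linarith

omit [DecidableEq ι] in
/-- **SIGN-SPLIT TYPE CRITERION (negative type).**  `F(t)u = 0` with `t > 0`; the Rayleigh coefficients `uᵀSₖu` are `≥ 0` for
`dₖ < e` and `≤ 0` for `dₖ > e`, and one of them with `dₖ ≠ e` is non-zero.  Then `P_u′(t) < 0`. [folklore] -/
theorem negType_of_signSplit (d : κ → ℕ) (S : κ → Matrix ι ι ℝ) (e : ℕ) (t : ℝ) (ht : 0 < t) (u : ι → ℝ)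
    (hu : (∑ k, t ^ d k • S k) *ᵥ u = 0)
    (hlo : ∀ k, d k < e → 0 ≤ u ⬝ᵥ (S k *ᵥ u)) (hhi : ∀ k, e < d k → u ⬝ᵥ (S k *ᵥ u) ≤ 0)
    (hne : ∃ k, d k ≠ e ∧ u ⬝ᵥ (S k *ᵥ u) ≠ 0) :
    (derivative (∑ k, C (u ⬝ᵥ (S k *ᵥ u)) * (X : ℝ[X]) ^ d k)).eval t < 0 := by
  -- apply the positive-type criterion to `−F`
  have hu' : (∑ k, t ^ d k • (-S k)) *ᵥ u = 0 := by
    have h : (∑ k, t ^ d k • (-S k)) = -(∑ k, t ^ d k • S k) := by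
      rw [← Finset.sum_neg_distrib]
      exact Finset.sum_congr rfl fun k _ => smul_neg _ _
    rw [h, Matrix.neg_mulVec, hu, neg_zero]
  have hq : ∀ k, u ⬝ᵥ ((-S k) *ᵥ u) = -(u ⬝ᵥ (S k *ᵥ u)) := fun k => by
    rw [Matrix.neg_mulVec, dotProduct_neg]
  have h := posType_of_signSplit d (fun k => -S k) e t ht u hu'
    (fun k hk => by rw [hq]; exact neg_nonpos.2 (hlo k hk))
    (fun k hk => by rw [hq]; exact neg_nonneg.2 (hhi k hk))
    (by obtain ⟨k, hk, ha⟩ := hne; exact ⟨k, hk, by rw [hq]; exact neg_ne_zero.2 ha⟩)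
  have hpoly : (∑ k, C (u ⬝ᵥ ((-S k) *ᵥ u)) * (X : ℝ[X]) ^ d k)
      = -(∑ k, C (u ⬝ᵥ (S k *ᵥ u)) * (X : ℝ[X]) ^ d k) := by
    rw [← Finset.sum_neg_distrib]
    refine Finset.sum_congr rfl fun k _ => ?_
    rw [hq, map_neg, neg_mul]
  rw [hpoly, derivative_neg, eval_neg] at h
  linarith

section Chain

variable {K : ℕ}

/-- **Every positive root of a Loewner chain is of POSITIVE type.**  Exponents strictly increasing, pivot index `p`, head
`Sₗ ⪯ 0` (`l < p`), tail `S_p ⪯ S_{p+1} ⪯ ⋯`, `det F ≢ 0`: at a positive root `t`, every kernel vector `u ≠ 0` has `P_u′(t) > 0`.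
[folklore] -/
theorem chain_posType (d : Fin K → ℕ) (hd : StrictMono d) (S : Fin K → Matrix ι ι ℝ) (p : Fin K)
    (hhead : ∀ l, l < p → (-S l).PosSemidef) (htail : ∀ i j, p ≤ i → i ≤ j → (S j - S i).PosSemidef)
    (hdet : Matrix.det (∑ k, ((X : ℝ[X]) ^ d k) • (S k).map C) ≠ 0)
    (t : ℝ) (ht : 0 < t) (u : ι → ℝ) (hu : (∑ k, t ^ d k • S k) *ᵥ u = 0) (hu0 : u ≠ 0) :
    0 < (derivative (∑ k, C (u ⬝ᵥ (S k *ᵥ u)) * (X : ℝ[X]) ^ d k)).eval t := by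
  set a : Fin K → ℝ := fun k => u ⬝ᵥ (S k *ᵥ u) with ha
  have hK : 0 < K := Fin.pos p
  -- sign facts: head `≤ 0`, tail non-decreasing
  have hheadle : ∀ k, k < p → a k ≤ 0 := by
    intro k hk
    have h := (hhead k hk).dotProduct_mulVec_nonneg u
    rw [star_trivial, Matrix.neg_mulVec, dotProduct_neg] at h
    simp only [ha]
    linarith
  have hmono : ∀ i j, p ≤ i → i ≤ j → a i ≤ a j := by
    intro i j hi hij
    have h := (htail i j hi hij).dotProduct_mulVec_nonneg u
    rw [star_trivial, Matrix.sub_mulVec, dotProduct_sub] at h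
    simp only [ha]
    linarith
  -- the threshold index `q`: coefficients `≤ 0` before it, `≥ 0` after it
  obtain ⟨q, hq1, hq2⟩ : ∃ q : Fin K, (∀ k, k < q → a k ≤ 0) ∧ (∀ k, q < k → 0 ≤ a k) := by
    by_cases hex : ∃ k, p ≤ k ∧ 0 ≤ a k
    · have hne : (univ.filter fun k : Fin K => p ≤ k ∧ 0 ≤ a k).Nonempty := by
        obtain ⟨k, hk⟩ := hex
        exact ⟨k, Finset.mem_filter.2 ⟨Finset.mem_univ _, hk⟩⟩
      set q := (univ.filter fun k : Fin K => p ≤ k ∧ 0 ≤ a k).min' hne with hqdef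
      have hqmem := Finset.mem_filter.1 (Finset.min'_mem _ hne)
      refine ⟨q, fun k hk => ?_, fun k hk => ?_⟩
      · by_cases hkp : k < p
        · exact hheadle k hkp
        · push Not at hkp
          by_contra hpos
          push Not at hpos
          have hkmem : k ∈ univ.filter (fun k : Fin K => p ≤ k ∧ 0 ≤ a k) :=
            Finset.mem_filter.2 ⟨Finset.mem_univ _, hkp, hpos.le⟩
          exact absurd (Finset.min'_le _ k hkmem) (not_le.2 hk)
      · exact hqmem.2.2.trans (hmono q k hqmem.2.1 hk.le)
    · push Not at hex
      refine ⟨⟨K - 1, by omega⟩, fun k hk => ?_, fun k hk => ?_⟩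
      · by_cases hkp : k < p
        · exact hheadle k hkp
        · push Not at hkp
          exact (hex k hkp).le
      · exfalso
        have := k.2
        rw [Fin.lt_def] at hk
        simp only at hk
        omega
  -- non-degeneracy: some coefficient off `q` is non-zero, else `det F ≡ 0`
  have hne : ∃ k, d k ≠ d q ∧ a k ≠ 0 := by
    by_contra hall
    push Not at hall
    have hall' : ∀ k, k ≠ q → a k = 0 := fun k hk => hall k (fun h => hk (hd.injective h))
    -- `P_u(t) = 0` kills the remaining coefficient as well
    have hPu : ∑ k, t ^ d k * a k = 0 := by
      have h := OneAlternation.dotProduct_family_mulVec (fun k => t ^ d k) S u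
      rw [hu, dotProduct_zero] at h
      exact h.symm
    have haq : a q = 0 := by
      rw [← Finset.add_sum_erase univ _ (Finset.mem_univ q)] at hPu
      have h0 : ∑ k ∈ univ.erase q, t ^ d k * a k = 0 :=
        Finset.sum_eq_zero fun k hk => by rw [hall' k (Finset.ne_of_mem_erase hk), mul_zero]
      rw [h0, add_zero] at hPu
      exact (mul_eq_zero.1 hPu).resolve_left (pow_ne_zero _ ht.ne')
    have hzero : ∀ k, a k = 0 := fun k => by
      by_cases hk : k = q
      · rw [hk]; exact haq
      · exact hall' k hk
    -- head letters kill `u`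
    have hheadu : ∀ k, k < p → S k *ᵥ u = 0 := by
      intro k hk
      have h := (hhead k hk).dotProduct_mulVec_zero_iff u
      rw [star_trivial, Matrix.neg_mulVec, dotProduct_neg, neg_eq_zero, neg_eq_zero] at h
      exact h.1 (hzero k)
    -- tail letters agree on `u`
    have htailu : ∀ k, p ≤ k → S k *ᵥ u = S p *ᵥ u := by
      intro k hk
      have h := (htail p k le_rfl hk).dotProduct_mulVec_zero_iff u
      rw [star_trivial, Matrix.sub_mulVec, dotProduct_sub] at h
      have h2 : S k *ᵥ u - S p *ᵥ u = 0 := h.1 (by simp only [ha] at hzero; rw [hzero k, hzero p, sub_self])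
      exact sub_eq_zero.1 h2
    -- hence `F(x)u = (∑_{k ≥ p} x^{dₖ}) • S_p u` for every `x`
    have hFx : ∀ x : ℝ, (∑ k, x ^ d k • S k) *ᵥ u = (∑ k ∈ univ.filter (fun k => p ≤ k), x ^ d k) • (S p *ᵥ u) := by
      intro x
      rw [Matrix.sum_mulVec, Finset.sum_smul,
        ← Finset.sum_filter_add_sum_filter_not univ (fun k => p ≤ k)]
      have h2 : ∑ k ∈ univ.filter (fun k => ¬ p ≤ k), (x ^ d k • S k) *ᵥ u = 0 :=
        Finset.sum_eq_zero fun k hk => by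
          rw [Matrix.smul_mulVec, hheadu k (not_le.1 (Finset.mem_filter.1 hk).2), smul_zero]
      rw [h2, add_zero]
      refine Finset.sum_congr rfl fun k hk => ?_
      rw [Matrix.smul_mulVec, htailu k (Finset.mem_filter.1 hk).2]
    have hw : S p *ᵥ u = 0 := by
      have h := hFx t
      rw [hu] at h
      have hpos : 0 < ∑ k ∈ univ.filter (fun k => p ≤ k), t ^ d k :=
        Finset.sum_pos (fun k _ => pow_pos ht _) ⟨p, Finset.mem_filter.2 ⟨Finset.mem_univ _, le_rfl⟩⟩
      exact (smul_eq_zero.1 h.symm).resolve_left hpos.ne'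
    have hzero' : ∀ x : ℝ, (∑ k, x ^ d k • S k) *ᵥ u = 0 := fun x => by rw [hFx x, hw, smul_zero]
    apply hdet
    apply Polynomial.funext
    intro x
    rw [DefiniteMoments.eval_det_pencil, eval_zero]
    exact (Matrix.exists_mulVec_eq_zero_iff).1 ⟨u, hu0, hzero' x⟩
  refine posType_of_signSplit d S (d q) t ht u hu (fun k hk => hq1 k (hd.lt_iff_lt.1 hk))
    (fun k hk => hq2 k (hd.lt_iff_lt.1 hk)) hne

/-- **LOEWNER CHAINS ARE EXACT.**  `F(X) = ∑ₗ X^{dₗ}Sₗ` (`l < K`, `K ≥ 1`), exponents strictly increasing, real symmetric letters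
with a pivot index `p`: `Sₗ ⪯ 0` for `l < p` and `S_p ⪯ S_{p+1} ⪯ ⋯ ⪯ S_{K−1}` (pivot and tail letters individually arbitrary);
extreme letters `S₀`, `S_{K−1}` non-singular.  Then the positive roots of `det F` counted with multiplicity satisfy
`Z₊ + ν(S_{K−1}) = ν(S₀)` and `Z₊ + π(S₀) = π(S_{K−1})` — the tree's `chainSector` inequality `Z₊ ≤ card ι` as an identity.
[folklore] -/
theorem chainSector_exact (hK : 0 < K) (d : Fin K → ℕ) (hd : StrictMono d) (S : Fin K → Matrix ι ι ℝ)
    (hS : ∀ k, (S k).IsSymm) (p : Fin K)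
    (hhead : ∀ l, l < p → (-S l).PosSemidef) (htail : ∀ i j, p ≤ i → i ≤ j → (S j - S i).PosSemidef)
    (h₀ : (S ⟨0, hK⟩).det ≠ 0) (h₁ : (S ⟨K - 1, by omega⟩).det ≠ 0) :
    Multiset.card ((Matrix.det (∑ k, ((X : ℝ[X]) ^ d k) • (S k).map C)).roots.filter (fun t => 0 < t))
        + Fintype.card {j // (isHermitian_of_isSymm (hS ⟨K - 1, by omega⟩)).eigenvalues j < 0}
      = Fintype.card {j // (isHermitian_of_isSymm (hS ⟨0, hK⟩)).eigenvalues j < 0} ∧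
    Multiset.card ((Matrix.det (∑ k, ((X : ℝ[X]) ^ d k) • (S k).map C)).roots.filter (fun t => 0 < t))
        + Fintype.card {j // 0 < (isHermitian_of_isSymm (hS ⟨0, hK⟩)).eigenvalues j}
      = Fintype.card {j // 0 < (isHermitian_of_isSymm (hS ⟨K - 1, by omega⟩)).eigenvalues j} := by
  classical
  have hmin : ∀ l : Fin K, l ≠ ⟨0, hK⟩ → d ⟨0, hK⟩ < d l := by
    intro l hl
    apply hd
    rw [Fin.lt_def]
    have : (l : ℕ) ≠ 0 := fun h => hl (Fin.ext h)
    simp only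
    omega
  have hmax : ∀ l : Fin K, l ≠ ⟨K - 1, by omega⟩ → d l < d ⟨K - 1, by omega⟩ := by
    intro l hl
    apply hd
    rw [Fin.lt_def]
    have h2 := l.2
    have : (l : ℕ) ≠ K - 1 := fun h => hl (Fin.ext h)
    simp only
    omega
  obtain ⟨N, hN⟩ := Filter.eventually_atTop.1 (eventually_atTop_indices_eq d S hS ⟨K - 1, by omega⟩ hmax h₁)
  have hdet : Matrix.det (∑ k, ((X : ℝ[X]) ^ d k) • (S k).map C) ≠ 0 :=
    det_pencil_ne_zero_of_eval d S (hN N le_rfl).2.2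
  exact card_posRoots_multiset_eq_of_posType d S hS ⟨0, hK⟩ ⟨K - 1, by omega⟩ hmin hmax h₀ h₁
    (fun t ht _ u hu hu0 => chain_posType d hd S p hhead htail hdet t ht u hu hu0)

/-- **The pure Loewner chain is exact**: `S₀ ⪯ S₁ ⪯ ⋯ ⪯ S_{K−1}` at strictly increasing exponents with non-singular extreme letters
⇒ `Z₊ + ν(S_{K−1}) = ν(S₀)` and `Z₊ + π(S₀) = π(S_{K−1})` with multiplicity (e.g. `X•1 − diag(1,…,n)`: exactly `n`). [folklore] -/
theorem loewnerChain_exact (hK : 0 < K) (d : Fin K → ℕ) (hd : StrictMono d) (S : Fin K → Matrix ι ι ℝ)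
    (hS : ∀ k, (S k).IsSymm) (hchain : ∀ i j, i ≤ j → (S j - S i).PosSemidef)
    (h₀ : (S ⟨0, hK⟩).det ≠ 0) (h₁ : (S ⟨K - 1, by omega⟩).det ≠ 0) :
    Multiset.card ((Matrix.det (∑ k, ((X : ℝ[X]) ^ d k) • (S k).map C)).roots.filter (fun t => 0 < t))
        + Fintype.card {j // (isHermitian_of_isSymm (hS ⟨K - 1, by omega⟩)).eigenvalues j < 0}
      = Fintype.card {j // (isHermitian_of_isSymm (hS ⟨0, hK⟩)).eigenvalues j < 0} ∧
    Multiset.card ((Matrix.det (∑ k, ((X : ℝ[X]) ^ d k) • (S k).map C)).roots.filter (fun t => 0 < t))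
        + Fintype.card {j // 0 < (isHermitian_of_isSymm (hS ⟨0, hK⟩)).eigenvalues j}
      = Fintype.card {j // 0 < (isHermitian_of_isSymm (hS ⟨K - 1, by omega⟩)).eigenvalues j} :=
  chainSector_exact hK d hd S hS ⟨0, hK⟩ (fun _ hl => absurd (Fin.lt_def.1 hl) (Nat.not_lt_zero _))
    (fun i j _ hij => hchain i j hij) h₀ h₁

end Chain

end Inertia

end Summit.ValiantsHypothesis.ValiantsHypothesis.Theorems.LacunarySymmetroidMatrixDescartes
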